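import Summits.FinalStateConjecture.FinalStateConjecture.Theorems.SwallowTheDatumParametricKerrBurialCollarDilation
import Summits.FinalStateConjecture.FinalStateConjecture.Theorems.PhaseMixingCaptureCaptureSufficesStubDilationThread
import Summits.FinalStateConjecture.FinalStateConjecture.Theorems.KerrShieldedDataExist.Negative.SliceClause
import Literature.Geometry.Lorentzian.KerrSliceFacts
import HarnessLib

/-!
# Crux `PhaseMixingCapture.CaptureSufficesC2` (stmt-FinalStateConjecture-14986), line `Sketch`,
# stub `stub_exactBurialAtMassJunction` (S1′) — REDUCTION BY DILATION to a deep-pinned form of item 10052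

The registered Stub 1′ asks, for ONE shield mass `M > 0`, that through every admissible datum pass a jointly
smooth injective admissible family each of whose members `F c` (`c ≠ 0`) has an admissible DILATE `(λ² h, λ k)`
EXACTLY Kerr-shielded at the mass junction `Kerr.slice a M = {t* = 0, r > M}` by `(M, a)`, `|a| ≤ M/2`.  Its
gluing core is item stmt-FinalStateConjecture-10052 (`SwallowTheDatum.ParametricKerrBurial`, not in the tree).
This file proves the honest remainder, the DILATION BOOKKEEPING, sorry-free and definition-free:

* `exactShield_homothety_of_deepShield` (member lemma): if a datum `D` on a general `X` is exactly
  Kerr-shielded in the sense of item 10052 with parameters `(M, a, r₁)` — chart `φ : Kerr.slice a r₁ → X`,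
  bent graph `ψ`, normal `ν`, `φ^* h = ψ^* g_{M,a}`, `φ^* k = K_ν(ψ)` — and moreover `r₁ ≤ M` and the far zones
  `φ{r > R}` are co-compact, then for every `λ > 0` the homothety `D.homothety λ = (λ² h, λ k)`
  (`InitialDataHomothety.lean`) is exactly Kerr-shielded AT THE MASS JUNCTION by `(λM, λa)`: chart
  `φ ∘ σ` with `σ(z) = z/λ : Kerr.slice (λa) (λM) → Kerr.slice a r₁` (restriction to `{r > M}` then
  dilation), graph `ψ'(z) = λ ψ(z/λ)` of `T_{λM,λa}` (`bentHeight_scale`), the SAME normal vector; the metric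
  clause by Kerr–Schild homogeneity `g_{λM,λa}(λx) = g_{M,a}(x)` (`Kerr.bilin_dilate`) and
  `d(φ ∘ σ) = dφ ∘ λ⁻¹`, the second-fundamental-form clause by `K^{g'}_{ψ',ν'}(z) = λ⁻¹ K^{g}_{ψ,ν}(z/λ)`
  (`OpensChart.secondFundamentalForm_dilate`, O'Neill 1983, Ch. 4, Lemma 4.4) against `(φ ∘ σ)^*(λ k) = λ · λ⁻² φ^* k`;
* `stub_exactBurialAtMassJunction_of_deepPinnedBurial`: the registered statement of Stub 1′ VERBATIM, from the
  DEEP-PINNED PARAMETRIC KERR BURIAL displayed inline as hypothesis — item 10052's conclusion with three conjuncts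
  prepended to its shielding clause: `|a| ≤ M/2`, `r₁ ≤ M`, `∀ R, IsCompact (φ '' {R < r})ᶜ`.

NOT here: the gluing (item 10052 itself, XL) and the three pinnings.  References: Bartnik–Isenberg 2004, §2;
Kerr–Schild 1965, §2; O'Neill 1983, Ch. 4, Lemma 4.1/4.4; Dafermos–Rodnianski arXiv:0811.0354, §5.1; Hintz 2022.
-/

set_option linter.dupNamespace false

noncomputable section

-- instance search through the nested operator type `E3 →L[ℝ] E3 →L[ℝ] ℝ` (as in the tree files)
set_option maxSynthPendingDepth 3

open Set Filter Function Topology TopologicalSpace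
open scoped Manifold ContDiff Topology

namespace Summit.FinalStateConjecture.FinalStateConjecture.Theorems.CaptureSufficesC2.Sketch

open Literature.Geometry.Lorentzian
open Summit.FinalStateConjecture.FinalStateConjecture.Theorems.KerrShieldedDataExist.Negative
  (bentHeight ofTimeSpace_mem_region)
open Summit.FinalStateConjecture.FinalStateConjecture.Theorems.SwallowTheDatum.ParametricKerrBurial.CollarDilation
  (bentHeight_scale smoothMetric_val_eq_bilin_inv_smul)
open Summit.FinalStateConjecture.FinalStateConjecture.Theorems.CaptureSuffices.CaptureExportsCensorshipDiagonalSurgery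
  (homothety_mem_admissibleVacuumData)

namespace ExactBurialDilation

/-! ## Bilinear bookkeeping of the homothety against the contraction `v ↦ v/λ` -/

/-- `λ² B(A(v/λ), A(w/λ)) = B(Av, Aw)`: the metric of the homothety read through `d(φ ∘ σ) = dφ ∘ λ⁻¹`.
[folklore] -/
theorem sq_mul_bilin_apply_inv_smul (B : E3 →L[ℝ] E3 →L[ℝ] ℝ) (A : E3 →L[ℝ] E3) {c : ℝ} (hc : c ≠ 0)
    (v w : E3) : c ^ 2 * B (A (c⁻¹ • v)) (A (c⁻¹ • w)) = B (A v) (A w) := by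
  simp only [map_smul, FunLike.coe_smul, Pi.smul_apply, smul_eq_mul]
  field_simp

/-- `λ B(A(v/λ), A(w/λ)) = λ⁻¹ B(Av, Aw)`: the second fundamental form of the homothety read through
`d(φ ∘ σ) = dφ ∘ λ⁻¹`. [folklore] -/
theorem mul_bilin_apply_inv_smul (B : E3 →L[ℝ] E3 →L[ℝ] ℝ) (A : E3 →L[ℝ] E3) {c : ℝ} (hc : c ≠ 0)
    (v w : E3) : c * B (A (c⁻¹ • v)) (A (c⁻¹ • w)) = c⁻¹ * B (A v) (A w) := by
  simp only [map_smul, FunLike.coe_smul, Pi.smul_apply, smul_eq_mul]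
  field_simp

/-! ## The member lemma: a deep exact shield dilates to an exact shield at the mass junction -/

variable {X : Type} [TopologicalSpace X] [ChartedSpace E3 X] [IsManifold (𝓡 3) ∞ X]

/-- **A deep exact Kerr shield dilates to an exact shield at the mass junction.**  Let `D` on `X` be exactly
Kerr-shielded with parameters `(M, a, r₁)`, `|a| < M`, in the sense of item 10052 (chart `φ`, bent graph `ψ`
of `T_{M,a}`, future unit normal `ν`, `φ^* h = ψ^* g_{M,a}`, `φ^* k = K_ν(ψ)` on `Kerr.slice a r₁`), with the
junction at most the mass, `r₁ ≤ M`, and co-compact far zones `φ{r > R}`.  Then for every `λ > 0` the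
homothety `(λ² h, λ k)` of `D` is exactly Kerr-shielded on `Kerr.slice (λa) (λM)` by `(λM, λa)`: chart
`φ(·/λ)`, graph `λ ψ(·/λ)` of `T_{λM,λa}`, the same normal vector.  Bartnik–Isenberg 2004, §2 (scaling);
Kerr–Schild homogeneity; O'Neill 1983, Ch. 4, Lemma 4.4 (`K' = λ⁻¹ K`). [cite: ONeill1983, Ch. 4, Lemma 4.4] -/
theorem exactShield_homothety_of_deepShield [Kerr.Facts] (D : InitialDataSet (𝓡 3) X) {M a r₁ lam : ℝ}
    (hlam : 0 < lam) (hM : 0 ≤ M) (haM : |a| < M) (hr₁M : r₁ ≤ M)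
    (φ : Kerr.slice a r₁ → X) (hφs : ContMDiff 𝓘(ℝ, E3) (𝓡 3) ∞ φ) (hemb : Topology.IsOpenEmbedding φ)
    (hfar : ∀ R : ℝ,
      IsCompact (φ '' {y : Kerr.slice a r₁ | R < Kerr.radius a (E4.ofTimeSpace 0 (y : E3))})ᶜ)
    (ψ : Kerr.slice a r₁ → Kerr.region a r₁) (ν : NormalField 𝓘(ℝ, E4) ψ)
    (hψ : ∀ y : Kerr.slice a r₁, (ψ y : E4) =
      E4.ofTimeSpace (bentHeight M a (Kerr.radius a (E4.ofTimeSpace 0 (y : E3)))) (y : E3))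
    (himm : (Kerr.smoothMetric M a r₁).IsSpacelikeImmersion 𝓘(ℝ, E3) ψ)
    (hfun : (Kerr.smoothMetric M a r₁).IsFutureUnitNormal 𝓘(ℝ, E3)
      ((Kerr.timeOrientation M a r₁ hM).ofLE le_top) ψ ν)
    (hh : ∀ y : Kerr.slice a r₁,
      pullbackBilin (I := 𝓡 3) (I' := 𝓘(ℝ, E3)) φ D.h.inner y =
        pullbackBilin (I := 𝓘(ℝ, E4)) (I' := 𝓘(ℝ, E3)) ψ (Kerr.smoothMetric M a r₁).val y)
    (hk : ∀ [(Kerr.smoothMetric M a r₁).HasLeviCivita] (y : Kerr.slice a r₁),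
      (pullbackBilin (I := 𝓡 3) (I' := 𝓘(ℝ, E3)) φ D.k y).toLinearMap₁₂ =
        (Kerr.smoothMetric M a r₁).secondFundamentalForm 𝓘(ℝ, E3) ψ ν y) :
    ∃ (hM' : 0 ≤ lam * M) (φ' : Kerr.slice (lam * a) (lam * M) → X)
      (_hφ : ContMDiff 𝓘(ℝ, E3) (𝓡 3) (∞ + 1) φ')
      (_hφ' : ∀ u, Function.Injective (mfderiv 𝓘(ℝ, E3) (𝓡 3) φ' u))
      (ψ' : Kerr.slice (lam * a) (lam * M) → Kerr.region (lam * a) (lam * M))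
      (ν' : NormalField 𝓘(ℝ, E4) ψ'),
      |lam * a| < lam * M ∧ IsCompact (Set.range φ')ᶜ ∧ Topology.IsOpenEmbedding φ' ∧
      (∀ R : ℝ, IsCompact (φ' '' {y : Kerr.slice (lam * a) (lam * M) |
        R < Kerr.radius (lam * a) (E4.ofTimeSpace 0 (y : E3))})ᶜ) ∧
      (∀ y : Kerr.slice (lam * a) (lam * M), (ψ' y : E4) =
        E4.ofTimeSpace (bentHeight (lam * M) (lam * a)
          (Kerr.radius (lam * a) (E4.ofTimeSpace 0 (y : E3)))) (y : E3)) ∧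
      (Kerr.smoothMetric (lam * M) (lam * a) (lam * M)).IsSpacelikeImmersion 𝓘(ℝ, E3) ψ' ∧
      (Kerr.smoothMetric (lam * M) (lam * a) (lam * M)).IsFutureUnitNormal 𝓘(ℝ, E3)
        ((Kerr.timeOrientation (lam * M) (lam * a) (lam * M) hM').ofLE le_top) ψ' ν' ∧
      (∀ y : Kerr.slice (lam * a) (lam * M),
        pullbackBilin (I := 𝓡 3) (I' := 𝓘(ℝ, E3)) φ' (D.homothety lam hlam).h.inner y =
          pullbackBilin (I := 𝓘(ℝ, E4)) (I' := 𝓘(ℝ, E3)) ψ'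
            (Kerr.smoothMetric (lam * M) (lam * a) (lam * M)).val y) ∧
      (∀ [(Kerr.smoothMetric (lam * M) (lam * a) (lam * M)).HasLeviCivita]
        (y : Kerr.slice (lam * a) (lam * M)),
        (pullbackBilin (I := 𝓡 3) (I' := 𝓘(ℝ, E3)) φ' (D.homothety lam hlam).k y).toLinearMap₁₂ =
          (Kerr.smoothMetric (lam * M) (lam * a) (lam * M)).secondFundamentalForm 𝓘(ℝ, E3)
            ψ' ν' y) := by
  -- adapted from `Theorems/SwallowTheDatumParametricKerrBurialCollarDilation.lean` (`isKerrShieldedAway_dilate`)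
  have hM0 : 0 < M := (abs_nonneg a).trans_lt haM
  have hlM : 0 ≤ lam * M := (mul_pos hlam hM0).le
  /- 1. the restriction–contraction `σ : {r > λM}_{λa} → {r > r₁}_a`, `z ↦ z/λ` -/
  have hsub : Kerr.slice a M ≤ Kerr.slice a r₁ := fun y hy ↦
    Kerr.mem_slice_iff_ofTimeSpace_mem_region.2
      (Kerr.region_mono a hr₁M (Kerr.mem_slice_iff_ofTimeSpace_mem_region.1 hy))
  obtain ⟨σ, hσ, hσs, hσe⟩ : ∃ σ : Kerr.slice (lam * a) (lam * M) → Kerr.slice a r₁,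
      (∀ z, ((σ z : Kerr.slice a r₁) : E3) = lam⁻¹ • (z : E3)) ∧
      ContMDiff 𝓘(ℝ, E3) 𝓘(ℝ, E3) ∞ σ ∧ Topology.IsOpenEmbedding σ :=
    ⟨Opens.inclusion hsub ∘ Kerr.sliceShrink lam hlam a M, fun _ ↦ rfl,
      (contMDiff_inclusion hsub).comp (Kerr.contMDiff_sliceShrink hlam a M),
      (Opens.isOpenEmbedding_of_le hsub).comp (Kerr.sliceShrinkHomeomorph lam hlam a M).isOpenEmbedding⟩
  -- radius bookkeeping along `σ`
  have hσr : ∀ z, Kerr.radius a (E4.ofTimeSpace 0 ((σ z : Kerr.slice a r₁) : E3)) =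
      lam⁻¹ * Kerr.radius (lam * a) (E4.ofTimeSpace 0 (z : E3)) := fun z ↦ by
    have h := Kerr.radius_smul (inv_pos.2 hlam) (lam * a) (E4.ofTimeSpace 0 (z : E3))
    rw [← mul_assoc, inv_mul_cancel₀ hlam.ne', one_mul] at h
    rw [hσ, E4.ofTimeSpace_zero_smul, h]
  have hσM : ∀ z, M < Kerr.radius a (E4.ofTimeSpace 0 ((σ z : Kerr.slice a r₁) : E3)) := fun z ↦ by
    have hz : max (lam * M) 0 < Kerr.radius (lam * a) (E4.ofTimeSpace 0 (z : E3)) := Kerr.mem_slice.1 z.2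
    rw [hσr, lt_inv_mul_iff₀ hlam]
    exact (le_max_left _ _).trans_lt hz
  have hσsurj : ∀ y : Kerr.slice a r₁, M < Kerr.radius a (E4.ofTimeSpace 0 (y : E3)) → ∃ z, σ z = y := by
    intro y hy
    have hyM : (y : E3) ∈ Kerr.slice a M := by
      rw [Kerr.mem_slice, max_eq_left hM0.le]; exact hy
    refine ⟨⟨lam • (y : E3), (Kerr.mem_slice_dilate_iff hlam).2 hyM⟩, Subtype.ext ?_⟩
    rw [hσ, smul_smul, inv_mul_cancel₀ hlam.ne', one_smul]
  have hσd : ∀ z, MDifferentiableAt 𝓘(ℝ, E3) 𝓘(ℝ, E3) σ z := fun z ↦ hσs.mdifferentiableAt (by simp)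
  have hdσ : ∀ z (v : E3), mfderiv 𝓘(ℝ, E3) 𝓘(ℝ, E3) σ z v = lam⁻¹ • v := fun z v ↦ by
    rw [OpensChart.mfderiv_apply_of_repr (f := σ) (Φ := fun y : E3 ↦ lam⁻¹ • y) hσ
      ((lam⁻¹ • ContinuousLinearMap.id ℝ E3).differentiableAt)]
    exact congrFun (congrArg DFunLike.coe (lam⁻¹ • ContinuousLinearMap.id ℝ E3).fderiv) v
  /- 2. the dilated chart `φ ∘ σ`, the dilated graph `ψ' = λ ψ ∘ σ`, the same normal vector -/
  have hφd : ∀ y, MDifferentiableAt 𝓘(ℝ, E3) (𝓡 3) φ y := fun y ↦ hφs.mdifferentiableAt (by simp)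
  have hdφ : ∀ z (v : E3), mfderiv 𝓘(ℝ, E3) (𝓡 3) (φ ∘ σ) z v =
      mfderiv 𝓘(ℝ, E3) (𝓡 3) φ (σ z) (lam⁻¹ • v) := fun z v ↦ by
    rw [mfderiv_comp z (hφd (σ z)) (hσd z)]
    show mfderiv 𝓘(ℝ, E3) (𝓡 3) φ (σ z) (mfderiv 𝓘(ℝ, E3) 𝓘(ℝ, E3) σ z v) = _
    rw [hdσ]
  -- the data of the homothety read through the dilated chart: the `λ`'s cancel / leave `λ⁻¹`
  have hHφ : ∀ z (v w : E3), (D.homothety lam hlam).h.inner ((φ ∘ σ) z)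
      (mfderiv 𝓘(ℝ, E3) (𝓡 3) (φ ∘ σ) z v) (mfderiv 𝓘(ℝ, E3) (𝓡 3) (φ ∘ σ) z w) =
      D.h.inner (φ (σ z)) (mfderiv 𝓘(ℝ, E3) (𝓡 3) φ (σ z) v) (mfderiv 𝓘(ℝ, E3) (𝓡 3) φ (σ z) w) := by
    intro z v w
    rw [hdφ, hdφ]
    exact sq_mul_bilin_apply_inv_smul (D.h.inner (φ (σ z))) (mfderiv 𝓘(ℝ, E3) (𝓡 3) φ (σ z))
      hlam.ne' v w
  have hKφ : ∀ z (v w : E3), (D.homothety lam hlam).k ((φ ∘ σ) z)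
      (mfderiv 𝓘(ℝ, E3) (𝓡 3) (φ ∘ σ) z v) (mfderiv 𝓘(ℝ, E3) (𝓡 3) (φ ∘ σ) z w) =
      lam⁻¹ * D.k (φ (σ z)) (mfderiv 𝓘(ℝ, E3) (𝓡 3) φ (σ z) v) (mfderiv 𝓘(ℝ, E3) (𝓡 3) φ (σ z) w) := by
    intro z v w
    rw [hdφ, hdφ]
    exact mul_bilin_apply_inv_smul (D.k (φ (σ z))) (mfderiv 𝓘(ℝ, E3) (𝓡 3) φ (σ z)) hlam.ne' v w
  have hψd : ∀ y, MDifferentiableAt 𝓘(ℝ, E3) 𝓘(ℝ, E4) ψ y := fun y ↦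
    himm.contMDiff_self.mdifferentiableAt (by simp)
  obtain ⟨ψ', hf', hψ's⟩ : ∃ ψ' : Kerr.slice (lam * a) (lam * M) → Kerr.region (lam * a) (lam * M),
      (∀ z, (ψ' z : E4) = lam • (ψ (σ z) : E4)) ∧ ContMDiff 𝓘(ℝ, E3) 𝓘(ℝ, E4) ∞ ψ' := by
    refine ⟨fun z ↦ ⟨lam • (ψ (σ z) : E4), (Kerr.mem_region_dilate_iff hlam).2 ?_⟩, fun _ ↦ rfl, ?_⟩
    · rw [hψ]
      exact ofTimeSpace_mem_region _ ((Kerr.mem_slice (r₀ := M)).2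
        (by rw [max_eq_left hM0.le]; exact hσM z))
    · exact (ContMDiff.subtypeVal_comp_iff _ _).1
        (((lam • ContinuousLinearMap.id ℝ E4).contDiff.contMDiff).comp
          ((contMDiff_subtype_val.comp himm.contMDiff_self).comp hσs))
  obtain ⟨ν', hν'⟩ : ∃ ν' : NormalField 𝓘(ℝ, E4) ψ', ∀ z, (ν' z : E4) = ν (σ z) :=
    ⟨fun z ↦ (ν (σ z) : E4), fun _ ↦ rfl⟩
  have hdψ : ∀ z (v : E3), mfderiv 𝓘(ℝ, E3) 𝓘(ℝ, E4) ψ' z v =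
      mfderiv 𝓘(ℝ, E3) 𝓘(ℝ, E4) ψ (σ z) v := fun z v ↦
    OpensChart.mfderiv_dilate_apply hlam hσ hf' (hψd _) v
  have hG : ∀ x : Kerr.region a r₁, (Kerr.smoothMetric M a r₁).val x = Kerr.bilin M a x :=
    Kerr.smoothMetric_val M a r₁
  have hG' : ∀ x' : Kerr.region (lam * a) (lam * M),
      (Kerr.smoothMetric (lam * M) (lam * a) (lam * M)).val x' = Kerr.bilin M a (lam⁻¹ • (x' : E4)) :=
    smoothMetric_val_eq_bilin_inv_smul lam hlam M
  /- 3. the clauses -/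
  have himm' : (Kerr.smoothMetric (lam * M) (lam * a) (lam * M)).IsSpacelikeImmersion 𝓘(ℝ, E3) ψ' := by
    refine ⟨hψ's, fun z v hv ↦ ?_⟩
    have hpos := himm.2 (σ z) v hv
    rw [PseudoRiemannianMetric.inducedBilin_apply] at hpos ⊢
    rw [hdψ, hG', hf', smul_smul, inv_mul_cancel₀ hlam.ne', one_smul]
    rw [hG] at hpos
    exact hpos
  have hh' : ∀ z : Kerr.slice (lam * a) (lam * M),
      pullbackBilin (I := 𝓡 3) (I' := 𝓘(ℝ, E3)) (φ ∘ σ) (D.homothety lam hlam).h.inner z =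
        pullbackBilin (I := 𝓘(ℝ, E4)) (I' := 𝓘(ℝ, E3)) ψ'
          (Kerr.smoothMetric (lam * M) (lam * a) (lam * M)).val z := by
    intro z
    have key := hh (σ z)
    ext v w
    have kvw : D.h.inner (φ (σ z)) (mfderiv 𝓘(ℝ, E3) (𝓡 3) φ (σ z) v)
        (mfderiv 𝓘(ℝ, E3) (𝓡 3) φ (σ z) w) =
        (Kerr.smoothMetric M a r₁).val (ψ (σ z)) (mfderiv 𝓘(ℝ, E3) 𝓘(ℝ, E4) ψ (σ z) v)
          (mfderiv 𝓘(ℝ, E3) 𝓘(ℝ, E4) ψ (σ z) w) :=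
      DFunLike.congr_fun (DFunLike.congr_fun key v) w
    rw [hG] at kvw
    rw [pullbackBilin_apply, pullbackBilin_apply, hHφ, kvw, hdψ, hdψ, hG', hf', smul_smul,
      inv_mul_cancel₀ hlam.ne', one_smul]
    rfl
  have hφσi : ∀ u, Function.Injective (mfderiv 𝓘(ℝ, E3) (𝓡 3) (φ ∘ σ) u) := by
    intro u v w hvw
    by_contra hne
    have hpos := himm'.2 u (v - w) (sub_ne_zero.2 hne)
    have k2 := DFunLike.congr_fun (DFunLike.congr_fun (hh' u) (v - w)) (v - w)
    rw [pullbackBilin_apply, map_sub, hvw, sub_self, map_zero] at k2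
    rw [PseudoRiemannianMetric.inducedBilin_apply, ← pullbackBilin_apply, ← k2] at hpos
    exact lt_irrefl _ hpos
  refine ⟨hlM, φ ∘ σ, hφs.comp hσs, hφσi, ψ', ν', ?_, ?_, hemb.comp hσe, fun R ↦ ?_, fun z ↦ ?_, himm',
    ?_, hh', fun z ↦ ?_⟩
  · -- slow spin is scale invariant
    rw [abs_mul, abs_of_pos hlam]; exact mul_lt_mul_of_pos_left haM hlam
  · -- compact complement of the range: `range (φ ∘ σ) = φ{r > M}`
    have hr : Set.range (φ ∘ σ) =
        φ '' {y : Kerr.slice a r₁ | M < Kerr.radius a (E4.ofTimeSpace 0 (y : E3))} := by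
      ext x
      constructor
      · rintro ⟨z, rfl⟩
        exact ⟨σ z, hσM z, rfl⟩
      · rintro ⟨y, hy, rfl⟩
        obtain ⟨z, rfl⟩ := hσsurj y hy
        exact ⟨z, rfl⟩
    rw [hr]; exact hfar M
  · -- co-compact far zones: `(φ ∘ σ){r > R} = φ{r > max (R/λ) M}`
    have hr : (φ ∘ σ) '' {z : Kerr.slice (lam * a) (lam * M) |
          R < Kerr.radius (lam * a) (E4.ofTimeSpace 0 (z : E3))} =
        φ '' {y : Kerr.slice a r₁ | max (lam⁻¹ * R) M < Kerr.radius a (E4.ofTimeSpace 0 (y : E3))} := by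
      ext x
      simp only [Set.mem_image, Set.mem_setOf_eq, Function.comp_apply]
      constructor
      · rintro ⟨z, hz, rfl⟩
        refine ⟨σ z, max_lt ?_ (hσM z), rfl⟩
        rw [hσr z]
        exact mul_lt_mul_of_pos_left hz (inv_pos.2 hlam)
      · rintro ⟨y, hy, rfl⟩
        obtain ⟨z, rfl⟩ := hσsurj y ((le_max_right _ _).trans_lt hy)
        refine ⟨z, ?_, rfl⟩
        have h1 := (le_max_left _ _).trans_lt hy
        rw [hσr z] at h1
        exact lt_of_mul_lt_mul_left h1 (inv_pos.2 hlam).le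
    rw [hr]; exact hfar _
  · -- the graph of the dilated bent height (`bentHeight_scale`)
    have hz : (z : E3) = lam • ((σ z : Kerr.slice a r₁) : E3) := by
      rw [hσ, smul_smul, mul_inv_cancel₀ hlam.ne', one_smul]
    rw [hz, E4.ofTimeSpace_zero_smul, Kerr.radius_smul hlam, bentHeight_scale hlam haM,
      ← Kerr.smul_ofTimeSpace, ← hψ, hf']
  · -- future unit normal: the same vector, Kerr–Schild components are dilation invariant
    obtain ⟨⟨hn1, hn2⟩, hn3⟩ := hfun
    refine ⟨⟨fun z v ↦ ?_, fun z ↦ ?_⟩, fun z ↦ ?_⟩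
    · have h1 := hn1 (σ z) v
      rw [hG] at h1
      rw [hdψ, hG', hf', smul_smul, inv_mul_cancel₀ hlam.ne', one_smul, hν']
      exact h1
    · have h2 := hn2 (σ z)
      rw [hG] at h2
      rw [hG', hf', smul_smul, inv_mul_cancel₀ hlam.ne', one_smul, hν']
      exact h2
    · obtain ⟨⟨hc1, hc2⟩, hc3⟩ := hn3 (σ z)
      refine ⟨⟨?_, fun h0 ↦ hc2 ?_⟩, ?_⟩
      · show (Kerr.smoothMetric (lam * M) (lam * a) (lam * M)).val (ψ' z) (ν' z) (ν' z) ≤ 0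
        rw [hG] at hc1
        rw [hG', hf', smul_smul, inv_mul_cancel₀ hlam.ne', one_smul, hν']
        exact hc1
      · rw [← hν']; exact h0
      · show (Kerr.smoothMetric (lam * M) (lam * a) (lam * M)).val (ψ' z)
          (Kerr.timeVector (lam * M) (lam * a) (ψ' z : E4)) (ν' z) < 0
        change Kerr.bilin M a (ψ (σ z) : E4) (Kerr.timeVector M a (ψ (σ z) : E4)) (ν (σ z)) < 0 at hc3
        rw [hG', hf', smul_smul, inv_mul_cancel₀ hlam.ne', one_smul, hν', Kerr.timeVector_dilate hlam]
        exact hc3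
  · -- the second fundamental form: `K' = λ⁻¹ K` on both sides
    haveI : (Kerr.smoothMetric M a r₁).HasLeviCivita := PseudoRiemannianMetric.hasLeviCivita _
    have key := hk (σ z)
    have hsff := OpensChart.secondFundamentalForm_dilate
      (g := (Kerr.smoothMetric M a r₁).toPseudoRiemannianMetric)
      (g' := (Kerr.smoothMetric (lam * M) (lam * a) (lam * M)).toPseudoRiemannianMetric)
      hlam hσ hf' hG hG' hν' (hψd _) (Kerr.differentiableAt_bilin M a _) (z := z)
    refine LinearMap.ext fun v ↦ LinearMap.ext fun w ↦ ?_
    have kvw : D.k (φ (σ z)) (mfderiv 𝓘(ℝ, E3) (𝓡 3) φ (σ z) v) (mfderiv 𝓘(ℝ, E3) (𝓡 3) φ (σ z) w) =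
        (Kerr.smoothMetric M a r₁).secondFundamentalForm 𝓘(ℝ, E3) ψ ν (σ z) v w :=
      LinearMap.congr_fun₂ key v w
    have svw : (Kerr.smoothMetric (lam * M) (lam * a) (lam * M)).secondFundamentalForm 𝓘(ℝ, E3)
        ψ' ν' z v w =
        lam⁻¹ * (Kerr.smoothMetric M a r₁).secondFundamentalForm 𝓘(ℝ, E3) ψ ν (σ z) v w :=
      LinearMap.congr_fun₂ hsff v w
    rw [svw, ← kvw]
    exact hKφ z v w

end ExactBurialDilation

/-! ## The registered sub-goal: Stub 1′ from the deep-pinned parametric Kerr burial -/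

/-- **Stub 1′ (`stub_exactBurialAtMassJunction`, registered statement VERBATIM) from the DEEP-PINNED
PARAMETRIC KERR BURIAL** — item stmt-FinalStateConjecture-10052 `SwallowTheDatum.ParametricKerrBurial` with three
conjuncts PREPENDED to its shielding clause (`|a| ≤ M/2`, `r₁ ≤ M`, co-compact far zones `φ{r > R}`; the
rest is `IsKerrShielded X (F c)` of item 10052 verbatim), displayed inline as the hypothesis.  Proof: each member `F c`, `c ≠ 0`, is dilated by `λ = M / M_c` to the fixed shield
mass (`exactShield_homothety_of_deepShield`, `homothety_mem_admissibleVacuumData`).  The hypothesis is the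
parametric gluing of Hintz 2022 / Mao–Oh–Tao 2023 into a shielded background (Li–Mei 2020), NOT proved here.
[cite: Hintz2022, Thm 1.1–1.2] -/
theorem stub_exactBurialAtMassJunction_of_deepPinnedBurial :
    (∀ [Kerr.Facts] (X : Type) [TopologicalSpace X] [ChartedSpace E3 X] [IsManifold (𝓡 3) ∞ X]
        [T2Space X] [SecondCountableTopology X] [ConnectedSpace X],
        ∀ d ∈ admissibleVacuumData X,
          ∃ F : EuclideanSpace ℝ (Fin 1) → InitialDataSet (𝓡 3) X,
            InitialDataSet.IsSmoothDataFamily 1 F ∧ F 0 = d ∧ Function.Injective F ∧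
              (∀ c, F c ∈ admissibleVacuumData X) ∧
                ∀ c ≠ 0, ∃ (M a r₁ : ℝ) (hM : 0 ≤ M) (T : ℝ → ℝ) (φ : Kerr.slice a r₁ → X)
                  (ψ : Kerr.slice a r₁ → Kerr.region a r₁) (ν : NormalField 𝓘(ℝ, E4) ψ),
                  |a| ≤ M / 2 ∧ r₁ ≤ M ∧
                  (∀ R : ℝ, IsCompact
                    (φ '' {y : Kerr.slice a r₁ | R < Kerr.radius a (E4.ofTimeSpace 0 (y : E3))})ᶜ) ∧
                  |a| < M ∧ Kerr.rMinus M a < r₁ ∧ r₁ < Kerr.rPlus M a ∧ T = bentHeight M a ∧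
                  IsCompact (Set.range φ)ᶜ ∧ Topology.IsOpenEmbedding φ ∧
                  ContMDiff 𝓘(ℝ, E3) (𝓡 3) ∞ φ ∧
                  (∀ y : Kerr.slice a r₁, (ψ y : E4) =
                    E4.ofTimeSpace (T (Kerr.radius a (E4.ofTimeSpace 0 (y : E3)))) (y : E3)) ∧
                  (Kerr.smoothMetric M a r₁).IsSpacelikeImmersion 𝓘(ℝ, E3) ψ ∧
                  (Kerr.smoothMetric M a r₁).IsFutureUnitNormal 𝓘(ℝ, E3)
                    ((Kerr.timeOrientation M a r₁ hM).ofLE le_top) ψ ν ∧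
                  (∀ y : Kerr.slice a r₁,
                    pullbackBilin (I := 𝓡 3) (I' := 𝓘(ℝ, E3)) φ (F c).h.inner y =
                      pullbackBilin (I := 𝓘(ℝ, E4)) (I' := 𝓘(ℝ, E3)) ψ
                        (Kerr.smoothMetric M a r₁).val y) ∧
                  (∀ [(Kerr.smoothMetric M a r₁).HasLeviCivita] (y : Kerr.slice a r₁),
                    (pullbackBilin (I := 𝓡 3) (I' := 𝓘(ℝ, E3)) φ (F c).k y).toLinearMap₁₂ =
                      (Kerr.smoothMetric M a r₁).secondFundamentalForm 𝓘(ℝ, E3) ψ ν y)) →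
    ∀ [Kerr.Facts] [Kerr.SliceFacts] (M : ℝ), 0 < M →
      ∀ (X : Type) [TopologicalSpace X] [ChartedSpace E3 X] [IsManifold (𝓡 3) ∞ X] [T2Space X]
        [SecondCountableTopology X] [ConnectedSpace X],
        ∀ d ∈ admissibleVacuumData X,
          ∃ F : EuclideanSpace ℝ (Fin 1) → InitialDataSet (𝓡 3) X,
            InitialDataSet.IsSmoothDataFamily 1 F ∧ F 0 = d ∧ Function.Injective F ∧
              (∀ c, F c ∈ admissibleVacuumData X) ∧
                ∀ c ≠ 0, ∃ (D' : InitialDataSet (𝓡 3) X) (lam a : ℝ), 0 < lam ∧ |a| ≤ M / 2 ∧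
                  D' ∈ admissibleVacuumData X ∧
                  ((∀ (x : X) (v w : TangentSpace (𝓡 3) x),
                      D'.h.inner x v w = lam ^ 2 * (F c).h.inner x v w) ∧
                    ∀ (x : X) (v w : TangentSpace (𝓡 3) x), D'.k x v w = lam * (F c).k x v w) ∧
                  (∃ (hM : 0 ≤ M) (φ : Kerr.slice a M → X) (_hφ : ContMDiff 𝓘(ℝ, E3) (𝓡 3) (∞ + 1) φ)
                    (_hφ' : ∀ u, Function.Injective (mfderiv 𝓘(ℝ, E3) (𝓡 3) φ u))
                    (ψ : Kerr.slice a M → Kerr.region a M) (ν : NormalField 𝓘(ℝ, E4) ψ),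
                    |a| < M ∧ IsCompact (Set.range φ)ᶜ ∧ Topology.IsOpenEmbedding φ ∧
                    (∀ R : ℝ, IsCompact (φ '' {y : Kerr.slice a M | R < Kerr.radius a (E4.ofTimeSpace 0 (y : E3))})ᶜ) ∧
                    (∀ y : Kerr.slice a M, (ψ y : E4) =
                      E4.ofTimeSpace (bentHeight M a (Kerr.radius a (E4.ofTimeSpace 0 (y : E3)))) (y : E3)) ∧
                    (Kerr.smoothMetric M a M).IsSpacelikeImmersion 𝓘(ℝ, E3) ψ ∧
                    (Kerr.smoothMetric M a M).IsFutureUnitNormal 𝓘(ℝ, E3)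
                      ((Kerr.timeOrientation M a M hM).ofLE le_top) ψ ν ∧
                    (∀ y : Kerr.slice a M,
                      pullbackBilin (I := 𝓡 3) (I' := 𝓘(ℝ, E3)) φ D'.h.inner y =
                        pullbackBilin (I := 𝓘(ℝ, E4)) (I' := 𝓘(ℝ, E3)) ψ (Kerr.smoothMetric M a M).val y) ∧
                    (∀ [(Kerr.smoothMetric M a M).HasLeviCivita] (y : Kerr.slice a M),
                      (pullbackBilin (I := 𝓡 3) (I' := 𝓘(ℝ, E3)) φ D'.k y).toLinearMap₁₂ =
                        (Kerr.smoothMetric M a M).secondFundamentalForm 𝓘(ℝ, E3) ψ ν y)) := by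
  intro hDeep _ _ M hM X _ _ _ _ _ _ d hd
  obtain ⟨F, hF, hF0, hFi, hFa, hsh⟩ := hDeep X d hd
  refine ⟨F, hF, hF0, hFi, hFa, fun c hc ↦ ?_⟩
  obtain ⟨M₁, a₁, r₁, hM₁, T, φ, ψ, ν, ha2, hr₁M, hfar, haM, -, -, hT, -, hemb, hφs, hψ, himm, hfun,
    hh, hk⟩ := hsh c hc
  subst hT
  have hM₁pos : 0 < M₁ := (abs_nonneg a₁).trans_lt haM
  -- dilate the member by `λ := M / M₁`, so that its shield mass `λ M₁` IS the target mass `M`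
  obtain ⟨lam, hlam, rfl⟩ : ∃ lam : ℝ, 0 < lam ∧ lam * M₁ = M :=
    ⟨M / M₁, div_pos hM hM₁pos, div_mul_cancel₀ M hM₁pos.ne'⟩
  refine ⟨(F c).homothety lam hlam, lam, lam * a₁, hlam, ?_, homothety_mem_admissibleVacuumData (hFa c) hlam,
    ⟨fun x v w ↦ (F c).homothety_h_inner hlam x v w, fun x v w ↦ (F c).homothety_k hlam x v w⟩,
    ExactBurialDilation.exactShield_homothety_of_deepShield (F c) hlam hM₁ haM hr₁M φ hφs hemb hfar ψ ν hψ
      himm hfun hh hk⟩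
  -- slow spin is scale invariant: `|λ a₁| ≤ λ M₁ / 2`
  rw [abs_mul, abs_of_pos hlam, mul_div_assoc]
  exact mul_le_mul_of_nonneg_left ha2 hlam.le

end Summit.FinalStateConjecture.FinalStateConjecture.Theorems.CaptureSufficesC2.Sketch

end
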